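import Literature.AnabelianGeometry.SemiGraphs.PSCUnrVerticialSeparatingCoveringsTwoComponentAffine
import Literature.AnabelianGeometry.SemiGraphs.PSCSeparatingCoveringsProofs2
import HarnessLib

/-!
# [CombGC] Prop. 1.2, the STURDY `Π^unr`-clauses of (i) AND (ii), at EVERY two-component one-node shape (pointed or unmarked second component)

Mochizuki, *A combinatorial version of the Grothendieck conjecture*, Tohoku Math. J. **59** (2007)
[CombGC], Prop. 1.2 p. 8 [cite: MochizukiCombGC2007, Prop 1.2 pp.8-9]: "under the further assumption that
`G` is sturdy, if `B₁ ∩ B₂` is open in `B₁` then `v₁ = v₂`, and the `Bᵢ` are commensurably terminal in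
`Π^unr_G`"; proof p. 9 (the `Π^unr`-separating coverings) [cite: MochizukiCombGC2007, Prop 1.2 proof p.9].
abc-iut FACT-LIST rows F-2828 `PSCDatum.UnrVerticialSeparatingCoverings` (abc-iut-w4-d081), and the
`Π^unr`-clauses of F-0459 / F-0438 (`UnrVerticialOpenInterDeterminesVertex`,
`UnrVerticialCommensurablyTerminal`, abc-iut-L3-t4); universal closures refuted, instance forms the content.

PROOF-ONLY file (abc-iut-f-164 gen 4).  OBSERVATION: abc-iut-w5-d047's door-D1 theorem
`unrVerticialSeparatingCoverings_of_twoComponentAffine` carries NO hypothesis on the number `s` of marked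
points on `C₁` nor on `r − s` — only the shape equations for `Π_{v₀}`, `Π_{v₁}`, `Π_ν`, the cusp groups and
the genus pins.  It therefore applies verbatim to ALL the two-component one-node shapes of this seat's gen 2:
the AFFINE shape (`s ≥ 2`, `r − s ≥ 2`), the shape POINTED ON BOTH SIDES (`1 ≤ s ≤ r − 1`, components with a
single marked point allowed: `PSCTwoComponentAffinePointedOrigin.lean`) and the shape with `C₁` UNMARKED
(`s = 0`: `PSCTwoComponentUnmarkedOrigin.lean`).  With abc-iut-w5-d183's formal steps
(`PSCSeparatingCoveringsProofs2`) this yields, at every such datum, F-2828 and BOTH sturdy `Π^unr`-clauses —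
in particular the `Π^unr`-clause of Prop. 1.2 (ii) at components with ONE marked point and at an unmarked
component, where the verticial/edge-like clause of (ii) is not yet in the tree (gen 3's resume point (ii)).

* `unrRows_of_twoComponent` — datum level, any `s`;
* `twoComponentOrigin_unrRows` — at every origin whose data have the two-component one-node shape (a
  hypothesis weaker than each of the three origin hypotheses of gens 2–3), the three `Π^unr` rows datum-wise;
  `twoComponentPointedOrigin_unrRows`, `twoComponentUnmarkedOrigin_unrRows` — the same stated over gen 2's
  pointed / unmarked origin hypotheses BY NAME.

A shape instance is consistency evidence for the typed schemata, not the printed statement for all pointed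
stable curves (cell FOUNDATIONS rows 13–14).  0 definitions; nothing here takes a side on [IUTchIII] Cor. 3.12.
-/

noncomputable section

namespace Literature.AnabelianGeometry.SemiGraphs

namespace PSCDatum

open scoped Pointwise
open Literature.GroupTheory.CombinatorialGroupTheory
open Literature.GroupTheory.CombinatorialGroupTheory.PuncturedSurfaceGroup (cuspInertia)
open SemiGraphOfAnabelioids (IsProSigmaCompletion)

section Datum

variable {P : Type} [Group P] [TopologicalSpace P] [IsTopologicalGroup P]
variable [CompactSpace P] [TotallyDisconnectedSpace P] {Sigma : Set ℕ} {g r : ℕ}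

/-- **F-2828 and the sturdy `Π^unr`-clauses of [CombGC] Prop. 1.2 (i)(ii) at EVERY two-component one-node
datum** — ANY number `s` of marked points on `C₁` (`s = 0`: `C₁` unmarked; `s = 1` or `s = r − 1`: a
component with one marked point; `2 ≤ s ≤ r − 2`: the affine shape), genera pinned:
`UnrVerticialSeparatingCoverings ∧ UnrVerticialOpenInterDeterminesVertex ∧ UnrVerticialCommensurablyTerminal`.
[cite: MochizukiCombGC2007, Prop 1.2 pp.8-9] -/
theorem unrRows_of_twoComponent (hne : Sigma.Nonempty)
    (hprime : ∀ p ∈ Sigma, p.Prime) (ι : PuncturedSurfaceGroup g r →* P)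
    (hι : IsProSigmaCompletion Sigma ι) (G : PSCDatum P) {g₀ s : ℕ} (e : G.graph.C ≃ Fin r)
    (hC : ∀ c', G.cuspGp c' = ((cuspInertia (g := g) (e c')).map ι).topologicalClosure)
    (n₀ : G.graph.N) (hN : ∀ n, n = n₀)
    (v₀ v₁ : G.graph.V) (hV : ∀ w, w = v₀ ∨ w = v₁) (ε : PuncturedSurfaceGroup g r)
    (hε : ε = ((List.finRange r).map fun j : Fin r =>
          if s ≤ (j : ℕ) then PuncturedSurfaceGroup.c (g := g) j else 1).prod *
        ((List.finRange g).map fun i : Fin g => if (i : ℕ) < g₀ then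
          PuncturedSurfaceGroup.a (r := r) i * PuncturedSurfaceGroup.b i *
            (PuncturedSurfaceGroup.a i)⁻¹ * (PuncturedSurfaceGroup.b i)⁻¹ else 1).prod)
    (hV₀ : G.vertGp v₀ = ((Subgroup.closure {x : PuncturedSurfaceGroup g r |
        (∃ i : Fin g, (i : ℕ) < g₀ ∧ (x = PuncturedSurfaceGroup.a i ∨ x = PuncturedSurfaceGroup.b i)) ∨
        ∃ j : Fin r, s ≤ (j : ℕ) ∧ x = PuncturedSurfaceGroup.c j}).map ι).topologicalClosure)
    (hV₁ : G.vertGp v₁ = ((Subgroup.closure {x : PuncturedSurfaceGroup g r |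
        (∃ i : Fin g, g₀ ≤ (i : ℕ) ∧ (x = PuncturedSurfaceGroup.a i ∨ x = PuncturedSurfaceGroup.b i)) ∨
        (∃ j : Fin r, (j : ℕ) < s ∧ x = PuncturedSurfaceGroup.c j) ∨ x = ε}).map ι).topologicalClosure)
    (hE : G.nodeGp n₀ = ((Subgroup.zpowers ε).map ι).topologicalClosure)
    (hgen₀ : G.genus v₀ = g₀) (hgen₁ : G.genus v₁ = g - g₀) :
    G.UnrVerticialSeparatingCoverings ∧ G.UnrVerticialOpenInterDeterminesVertex ∧
      G.UnrVerticialCommensurablyTerminal :=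
  have hU := G.unrVerticialSeparatingCoverings_of_twoComponentAffine hne hprime ι hι e hC n₀ hN v₀ v₁ hV ε
    hε hV₀ hV₁ hE hgen₀ hgen₁
  ⟨hU, G.unrVerticialOpenInterDeterminesVertex_of_separating hU,
    G.unrVerticialCommensurablyTerminal_of_separating hU⟩

end Datum

/-! ### Origin level: every two-component one-node origin -/

/-- **F-2828 and the sturdy `Π^unr`-clauses of Prop. 1.2 (i)(ii), datum-wise, at EVERY origin whose data
have the two-component one-node shape** (profinite `Π` in `Type`; ANY `s`; a hypothesis implied by each of
the affine / pointed / unmarked origin hypotheses of this seat's gens 2–3). [cite: MochizukiCombGC2007, Prop 1.2 pp.8-9] -/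
theorem twoComponentOrigin_unrRows (Ω : PSCOrigin.{0})
    (hΩ : ∀ ⦃Q : Type⦄ [Group Q] [TopologicalSpace Q] [IsTopologicalGroup Q] (G : PSCDatum Q),
      Ω.IsOfPSCType G → CompactSpace Q ∧ TotallyDisconnectedSpace Q ∧
        ∃ (S : Set ℕ) (g r g₀ s : ℕ) (ι : PuncturedSurfaceGroup g r →* Q) (e : G.graph.C ≃ Fin r)
          (v₀ v₁ : G.graph.V) (n₀ : G.graph.N) (ε : PuncturedSurfaceGroup g r),
          S.Nonempty ∧ (∀ p ∈ S, p.Prime) ∧ IsProSigmaCompletion S ι ∧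
          (∀ c, G.cuspGp c =
            ((PuncturedSurfaceGroup.cuspInertia (g := g) (e c)).map ι).topologicalClosure) ∧
          (∀ w, w = v₀ ∨ w = v₁) ∧ (∀ n, n = n₀) ∧
          ε = ((List.finRange r).map fun j : Fin r =>
            if s ≤ (j : ℕ) then PuncturedSurfaceGroup.c (g := g) j else 1).prod *
          ((List.finRange g).map fun i : Fin g => if (i : ℕ) < g₀ then
            PuncturedSurfaceGroup.a (r := r) i * PuncturedSurfaceGroup.b i *
              (PuncturedSurfaceGroup.a i)⁻¹ * (PuncturedSurfaceGroup.b i)⁻¹ else 1).prod ∧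
          G.vertGp v₀ = ((Subgroup.closure {x : PuncturedSurfaceGroup g r |
            (∃ i : Fin g, (i : ℕ) < g₀ ∧ (x = PuncturedSurfaceGroup.a i ∨ x = PuncturedSurfaceGroup.b i)) ∨
            ∃ j : Fin r, s ≤ (j : ℕ) ∧ x = PuncturedSurfaceGroup.c j}).map ι).topologicalClosure ∧
          G.vertGp v₁ = ((Subgroup.closure {x : PuncturedSurfaceGroup g r |
            (∃ i : Fin g, g₀ ≤ (i : ℕ) ∧ (x = PuncturedSurfaceGroup.a i ∨ x = PuncturedSurfaceGroup.b i)) ∨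
            (∃ j : Fin r, (j : ℕ) < s ∧ x = PuncturedSurfaceGroup.c j) ∨ x = ε}).map ι).topologicalClosure ∧
          G.nodeGp n₀ = ((Subgroup.zpowers ε).map ι).topologicalClosure ∧
          G.genus v₀ = g₀ ∧ G.genus v₁ = g - g₀) :
    ∀ ⦃Q : Type⦄ [Group Q] [TopologicalSpace Q] [IsTopologicalGroup Q] (G : PSCDatum Q),
      Ω.IsOfPSCType G → G.UnrVerticialSeparatingCoverings ∧ G.UnrVerticialOpenInterDeterminesVertex ∧
        G.UnrVerticialCommensurablyTerminal := by
  intro Q _ _ _ G hG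
  obtain ⟨hc, hd, S, g, r, g₀, s, ι, e, v₀, v₁, n₀, ε, hne, hprime, hι, hC, hV, hN, hε, hV₀, hV₁, hE, hgen₀,
    hgen₁⟩ := hΩ G hG
  haveI := hc
  haveI := hd
  exact G.unrRows_of_twoComponent hne hprime ι hι e hC n₀ hN v₀ v₁ hV ε hε hV₀ hV₁ hE hgen₀ hgen₁

/-- **At every origin of two-component data POINTED ON BOTH SIDES** (gen 2's origin hypothesis of
`PSCTwoComponentAffinePointedOrigin.lean`, `1 ≤ s ≤ r − 1`: components with a single marked point allowed):
F-2828 and both sturdy `Π^unr`-clauses of Prop. 1.2 (i)(ii), datum-wise.  The `Π^unr`-clause of (ii) is NEW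
at one-marked-point components. [cite: MochizukiCombGC2007, Prop 1.2 pp.8-9] -/
theorem twoComponentPointedOrigin_unrRows (Ω : PSCOrigin.{0})
    (hΩ : ∀ ⦃Q : Type⦄ [Group Q] [TopologicalSpace Q] [IsTopologicalGroup Q] (G : PSCDatum Q),
      Ω.IsOfPSCType G → CompactSpace Q ∧ T2Space Q ∧ TotallyDisconnectedSpace Q ∧
        ∃ (S : Set ℕ) (g r g₀ s : ℕ) (ι : PuncturedSurfaceGroup g r →* Q) (e : G.graph.C ≃ Fin r)
          (v₀ v₁ : G.graph.V) (n₀ : G.graph.N) (ε : PuncturedSurfaceGroup g r),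
          S.Nonempty ∧ (∀ p ∈ S, p.Prime) ∧ IsProSigmaCompletion S ι ∧ g₀ ≤ g ∧ 1 ≤ s ∧ s + 1 ≤ r ∧
          (1 ≤ g₀ ∨ 2 ≤ r - s) ∧ (1 ≤ g - g₀ ∨ 2 ≤ s) ∧
          (∀ c, G.cuspGp c =
            ((PuncturedSurfaceGroup.cuspInertia (g := g) (e c)).map ι).topologicalClosure) ∧
          (∀ w, w = v₀ ∨ w = v₁) ∧ (∀ n, n = n₀) ∧
          ε = ((List.finRange r).map fun j : Fin r =>
            if s ≤ (j : ℕ) then PuncturedSurfaceGroup.c (g := g) j else 1).prod *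
          ((List.finRange g).map fun i : Fin g => if (i : ℕ) < g₀ then
            PuncturedSurfaceGroup.a (r := r) i * PuncturedSurfaceGroup.b i *
              (PuncturedSurfaceGroup.a i)⁻¹ * (PuncturedSurfaceGroup.b i)⁻¹ else 1).prod ∧
          G.vertGp v₀ = ((Subgroup.closure {x : PuncturedSurfaceGroup g r |
            (∃ i : Fin g, (i : ℕ) < g₀ ∧ (x = PuncturedSurfaceGroup.a i ∨ x = PuncturedSurfaceGroup.b i)) ∨
            ∃ j : Fin r, s ≤ (j : ℕ) ∧ x = PuncturedSurfaceGroup.c j}).map ι).topologicalClosure ∧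
          G.vertGp v₁ = ((Subgroup.closure {x : PuncturedSurfaceGroup g r |
            (∃ i : Fin g, g₀ ≤ (i : ℕ) ∧ (x = PuncturedSurfaceGroup.a i ∨ x = PuncturedSurfaceGroup.b i)) ∨
            (∃ j : Fin r, (j : ℕ) < s ∧ x = PuncturedSurfaceGroup.c j) ∨ x = ε}).map ι).topologicalClosure ∧
          G.nodeGp n₀ = ((Subgroup.zpowers ε).map ι).topologicalClosure ∧
          G.genus v₀ = g₀ ∧ G.genus v₁ = g - g₀) :
    ∀ ⦃Q : Type⦄ [Group Q] [TopologicalSpace Q] [IsTopologicalGroup Q] (G : PSCDatum Q),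
      Ω.IsOfPSCType G → G.UnrVerticialSeparatingCoverings ∧ G.UnrVerticialOpenInterDeterminesVertex ∧
        G.UnrVerticialCommensurablyTerminal :=
  twoComponentOrigin_unrRows Ω fun Q _ _ _ G hG => by
    obtain ⟨hc, -, hd, S, g, r, g₀, s, ι, e, v₀, v₁, n₀, ε, hne, hprime, hι, -, -, -, -, -, hC, hV, hN, hε,
      hV₀, hV₁, hE, hgen₀, hgen₁⟩ := hΩ G hG
    exact ⟨hc, hd, S, g, r, g₀, s, ι, e, v₀, v₁, n₀, ε, hne, hprime, hι, hC, hV, hN, hε, hV₀, hV₁, hE, hgen₀,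
      hgen₁⟩

/-- **At every origin of two-component data with `C₁` UNMARKED** (gen 2's origin hypothesis of
`PSCTwoComponentUnmarkedOrigin.lean`, `s = 0`, `C₁` a closed component of genus `≥ 1`): F-2828 and both
sturdy `Π^unr`-clauses of Prop. 1.2 (i)(ii), datum-wise (the (ii)-clause NEW there).
[cite: MochizukiCombGC2007, Prop 1.2 pp.8-9] -/
theorem twoComponentUnmarkedOrigin_unrRows (Ω : PSCOrigin.{0})
    (hΩ : ∀ ⦃Q : Type⦄ [Group Q] [TopologicalSpace Q] [IsTopologicalGroup Q] (G : PSCDatum Q),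
      Ω.IsOfPSCType G → CompactSpace Q ∧ T2Space Q ∧ TotallyDisconnectedSpace Q ∧
        ∃ (S : Set ℕ) (g r g₀ s : ℕ) (ι : PuncturedSurfaceGroup g r →* Q) (e : G.graph.C ≃ Fin r)
          (v₀ v₁ : G.graph.V) (n₀ : G.graph.N) (ε : PuncturedSurfaceGroup g r),
          S.Nonempty ∧ (∀ p ∈ S, p.Prime) ∧ IsProSigmaCompletion S ι ∧ g₀ ≤ g ∧ s = 0 ∧ 1 ≤ r ∧
          (1 ≤ g₀ ∨ 2 ≤ r) ∧ 1 ≤ g - g₀ ∧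
          (∀ c, G.cuspGp c =
            ((PuncturedSurfaceGroup.cuspInertia (g := g) (e c)).map ι).topologicalClosure) ∧
          (∀ w, w = v₀ ∨ w = v₁) ∧ (∀ n, n = n₀) ∧
          ε = ((List.finRange r).map fun j : Fin r =>
            if s ≤ (j : ℕ) then PuncturedSurfaceGroup.c (g := g) j else 1).prod *
          ((List.finRange g).map fun i : Fin g => if (i : ℕ) < g₀ then
            PuncturedSurfaceGroup.a (r := r) i * PuncturedSurfaceGroup.b i *
              (PuncturedSurfaceGroup.a i)⁻¹ * (PuncturedSurfaceGroup.b i)⁻¹ else 1).prod ∧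
          G.vertGp v₀ = ((Subgroup.closure {x : PuncturedSurfaceGroup g r |
            (∃ i : Fin g, (i : ℕ) < g₀ ∧ (x = PuncturedSurfaceGroup.a i ∨ x = PuncturedSurfaceGroup.b i)) ∨
            ∃ j : Fin r, s ≤ (j : ℕ) ∧ x = PuncturedSurfaceGroup.c j}).map ι).topologicalClosure ∧
          G.vertGp v₁ = ((Subgroup.closure {x : PuncturedSurfaceGroup g r |
            (∃ i : Fin g, g₀ ≤ (i : ℕ) ∧ (x = PuncturedSurfaceGroup.a i ∨ x = PuncturedSurfaceGroup.b i)) ∨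
            (∃ j : Fin r, (j : ℕ) < s ∧ x = PuncturedSurfaceGroup.c j) ∨ x = ε}).map ι).topologicalClosure ∧
          G.nodeGp n₀ = ((Subgroup.zpowers ε).map ι).topologicalClosure ∧
          G.genus v₀ = g₀ ∧ G.genus v₁ = g - g₀) :
    ∀ ⦃Q : Type⦄ [Group Q] [TopologicalSpace Q] [IsTopologicalGroup Q] (G : PSCDatum Q),
      Ω.IsOfPSCType G → G.UnrVerticialSeparatingCoverings ∧ G.UnrVerticialOpenInterDeterminesVertex ∧
        G.UnrVerticialCommensurablyTerminal :=
  twoComponentOrigin_unrRows Ω fun Q _ _ _ G hG => by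
    obtain ⟨hc, -, hd, S, g, r, g₀, s, ι, e, v₀, v₁, n₀, ε, hne, hprime, hι, -, -, -, -, -, hC, hV, hN, hε,
      hV₀, hV₁, hE, hgen₀, hgen₁⟩ := hΩ G hG
    exact ⟨hc, hd, S, g, r, g₀, s, ι, e, v₀, v₁, n₀, ε, hne, hprime, hι, hC, hV, hN, hε, hV₀, hV₁, hE, hgen₀,
      hgen₁⟩

end PSCDatum

end Literature.AnabelianGeometry.SemiGraphs

end
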